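import Literature.NumberTheory.EllipticCurves.WeierstrassSchemeAffineChartOpen
import Literature.NumberTheory.EllipticCurves.WeierstrassSchemePoints
import Literature.AlgebraicGeometry.Motives.ProjectiveSpaceRingPoints
import Literature.AlgebraicGeometry.Motives.GrpObjOfAlgPoints
import HarnessLib

/-!
# An abelian-variety model of an elliptic curve from its addition and negation morphisms

Let `W` be an elliptic curve over a field `K` and `E_W = V₊(F) ⊂ ℙ²_K` its plane cubic as a
`K`-scheme (`WeierstrassCurve.scheme`). Silverman, *AEC* III.3.6: the chord–tangent law and the
negation are morphisms `E × E → E`, `E → E`, which makes `E` a group variety, i.e. (being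
projective and geometrically integral) an abelian variety of dimension one. This file performs the
**assembly step** of that theorem: *given* `K`-morphisms

* `add : E_W ×_K E_W → E_W` restricting on `K̄`-points to Mathlib's group law of
  `W(K̄) = (W.baseChange K̄)⟮K̄⟯` under the dictionary `W.pointEquiv : W(L) ≃ E_W(L)` of
  `EllipticCurves/WeierstrassSchemePoints`, and
* `neg : E_W → E_W` restricting to negation,

it produces

* the unit section `WeierstrassCurve.oneHom W : Spec K → E_W` (the `K`-point `O = [0 : 1 : 0]`) and
  its value on `L`-points (`toUnit_comp_oneHom`, via the functoriality
  `specOverOfAlgHom_comp_schemePoint` of homogeneous coordinates under field extensions);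
* the group-scheme structure `WeierstrassCurve.grpObjOfAddHom` on `E_W` (the axioms hold because
  they hold on `K̄`-points: `Motives/GrpObjOfAlgPoints`), the abelian variety
  `WeierstrassCurve.abelianVarietyOfAddHom` (`E_W → Spec K` is proper and geometrically integral,
  `EllipticCurves/WeierstrassScheme`), and the identification of geometric points
  `geomPointsEquivOfAddHom : E_W(K̄) ≃+ W(K̄)`;
* the proof that this is an abelian-variety model of `W` in the sense of
  `EllipticCurves/AbelianVarietyModel` (`isAbelianVarietyModel_ofAddHom`: the chart is the open
  immersion `Spec K[W] ↪ E_W` of `EllipticCurves/WeierstrassSchemeAffineChartOpen`, Galois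
  equivariance is `smul_pointEquiv`, and chart points are `[x : y : 1]`, `chartPoint_affineChart`);
* hence (`EllipticCurves/AbelianVarietyModelIsogeny`) the named facts of
  `EllipticCurves/AbelianVarietyBridge(Full)` for two elliptic curves each equipped with such
  morphisms: `nonempty_abelianVarietyBridgeFull_of_addHom`, `nonempty_abelianVarietyBridge_of_addHom`,
  `nonempty_abelianVarietyBridge_symm_of_addHom`.

What remains for `nonempty_abelianVarietyBridge_holds` is thus exactly the construction of `add`
and `neg` as morphisms with these values on points (AEC III.3.6 proper; Bosma–Lenstra for explicit
complete systems of addition laws, cf. `EllipticCurves/WeierstrassAddLawsComplete`).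

## References

* J. H. Silverman, *The Arithmetic of Elliptic Curves*, 2nd ed., GTM 106 (2009): III.2, III.3.1(c),
  III.3.6. [SilvermanAEC2009]
* D. Mumford, *Abelian Varieties* (1970), §4. [MumfordAV1970]

## Design

`namespace WeierstrassCurve` (dot-notation extensions, as the sibling files). The hypotheses on
`add`/`neg` are stated on `K̄`-points only (`K̄ = AlgebraicClosure K`), in the direction
`W(K̄) → E_W(K̄)` of `W.pointEquiv`.
-/

noncomputable section

open CategoryTheory AlgebraicGeometry MonoidalCategory CartesianMonoidalCategory MvPolynomial
open Literature.AlgebraicGeometry.Motives Literature.NumberTheory.EllipticCurves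
open scoped Classical

universe u

namespace WeierstrassCurve

variable {K : Type u} [Field K] (W : WeierstrassCurve K)

attribute [local instance] MvPolynomial.gradedAlgebra ProjBaseChange.algebraBase

/-! ### Homogeneous coordinates under field extensions -/

section Functoriality

variable {L L' : Type u} [Field L] [Algebra K L] [Field L'] [Algebra K L'] (g : L →ₐ[K] L')

/-- A non-zero vector stays non-zero under a field embedding. [folklore] -/
theorem comp_vec_ne_zero {v : Fin 3 → L} (hv : v ≠ 0) : (fun j ↦ g (v j)) ≠ 0 := by
  obtain ⟨i, hi⟩ := Function.ne_iff.mp hv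
  exact Function.ne_iff.mpr ⟨i, by simpa using hi⟩

/-- The homogeneous Weierstrass equation is preserved by field embeddings over `K`. [folklore] -/
theorem equation_comp_vec {v : Fin 3 → L} (hEq : (W.baseChange L).toProjective.Equation v) :
    (W.baseChange L').toProjective.Equation (fun j ↦ g (v j)) := by
  rw [← W.aeval_toProjective_polynomial_eq_zero_iff] at hEq ⊢
  have h := DFunLike.congr_fun (MvPolynomial.comp_aeval (f := v) g) W.toProjective.polynomial
  simp only [AlgHom.coe_comp, Function.comp_apply] at h
  rw [← h, hEq, map_zero]

/-- **Functoriality of homogeneous coordinates**: for a `K`-embedding `g : L → L'`, the `L'`-point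
`Spec L' → Spec L → E_W` under the point `[v]` is the point `[g ∘ v]` (Hartshorne II Ex. 2.7;
Silverman, *AEC* III.2, `E(L) ⊆ E(L')`). [cite: SilvermanAEC2009, III.2] -/
theorem specOverOfAlgHom_comp_schemePoint (v : Fin 3 → L) (hv : v ≠ 0)
    (hEq : (W.baseChange L).toProjective.Equation v) :
    specOverOfAlgHom g ≫ W.schemePoint v hv hEq =
      W.schemePoint (fun j ↦ g (v j)) (comp_vec_ne_zero g hv) (W.equation_comp_vec g hEq) := by
  apply AlgPoints.map_injective_of_mono W.schemeι
  have e1 : AlgPoints.map W.schemeι (specOverOfAlgHom g ≫ W.schemePoint v hv hEq) =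
      specOverOfAlgHom g ≫ AlgPoints.map W.schemeι (W.schemePoint v hv hEq) := by
    rw [AlgPoints.map_apply, AlgPoints.map_apply, Category.assoc]
  rw [e1, map_schemeι_schemePoint, map_schemeι_schemePoint]
  obtain ⟨i, hi⟩ := Function.ne_iff.mp hv
  have hi' : (fun j ↦ g (v j)) i ≠ 0 := by simpa using hi
  rw [ProjectiveSpace.pointOfVec_eq_chartPoint v hv (ProjectiveSpace.X_mem i) one_pos
      (ProjectiveSpace.aeval_X_ne_zero hi),
    ProjectiveSpace.pointOfVec_eq_chartPoint _ (comp_vec_ne_zero g hv) (ProjectiveSpace.X_mem i)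
      one_pos (ProjectiveSpace.aeval_X_ne_zero hi'),
    ← ProjectiveSpace.vecChartPoint_eq_chartPoint, ← ProjectiveSpace.vecChartPoint_eq_chartPoint,
    ProjectiveSpace.specOverOfAlgHom_comp_vecChartPoint]

end Functoriality

/-! ### The unit section `O : Spec K → E_W` -/

section Unit

/-- The `K`-rational point `O = [0 : 1 : 0]` of `E_W`. [cite: SilvermanAEC2009, III.2] -/
def unitPoint : AlgPoints W.scheme K :=
  W.schemePoint ![0, 1, 0] fin3_zero_one_zero_ne_zero Projective.equation_zero

/-- **The unit section** `O : Spec K → E_W` as a morphism from the monoidal unit of `Over (Spec K)`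
(Silverman, *AEC* III.2: `O` is defined over `K`). [cite: SilvermanAEC2009, III.2] -/
def oneHom : 𝟙_ (SchemeOver K) ⟶ W.scheme :=
  Over.homMk W.unitPoint.left <| by
    refine (Over.w W.unitPoint).trans ?_
    change Spec.map (CommRingCat.ofHom (algebraMap K K)) = 𝟙 (Spec (CommRingCat.of K))
    rw [Algebra.algebraMap_self, CommRingCat.ofHom_id]
    exact Spec.map_id _

/-- The underlying morphism of `oneHom` is that of the `K`-point `O`. [folklore] -/
theorem oneHom_left : W.oneHom.left = W.unitPoint.left := rfl

variable (L : Type u) [Field L] [Algebra K L]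

/-- **The value of the unit section on `L`-points is `O = [0 : 1 : 0] ∈ E_W(L)`.**
[cite: SilvermanAEC2009, III.2] -/
theorem toUnit_comp_oneHom :
    toUnit (specOver K L) ≫ W.oneHom =
      W.schemePoint (L := L) ![0, 1, 0] fin3_zero_one_zero_ne_zero Projective.equation_zero := by
  have h1 : toUnit (specOver K L) ≫ W.oneHom = specOverOfAlgHom (Algebra.ofId K L) ≫ W.unitPoint :=
    Over.OverMorphism.ext (by
      rw [Over.comp_left, Over.comp_left, oneHom_left, Over.toUnit_left, specOverOfAlgHom_left]
      rfl)
  rw [h1, unitPoint, specOverOfAlgHom_comp_schemePoint]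
  congr 1
  funext j
  fin_cases j <;> simp

/-- … i.e. `O` corresponds to `0 ∈ W(L)` under `pointEquiv`. [cite: SilvermanAEC2009, III.2] -/
theorem toUnit_comp_oneHom_eq_pointEquiv_zero [W.IsElliptic] :
    toUnit (specOver K L) ≫ W.oneHom = W.pointEquiv (0 : (W.baseChange L).toAffine.Point) := by
  rw [toUnit_comp_oneHom, pointEquiv_zero]

end Unit

/-! ### The group scheme, the abelian variety and the model -/

section Model

variable [W.IsElliptic]

variable (add : W.scheme ⊗ W.scheme ⟶ W.scheme) (neg : W.scheme ⟶ W.scheme)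

local notation "K̄" => AlgebraicClosure K

/-- The dictionary `E_W(K̄) → W(K̄)`, `P ↦ pointEquiv⁻¹ P`, valued in the `Γ_K`-module
`W.geomPoints` of `EllipticCurves/GaloisAction`. [cite: SilvermanAEC2009, III.2] -/
def toGeomPoint (P : AlgPoints W.scheme K̄) : W.geomPoints :=
  (W.pointEquiv (L := K̄)).symm P

/-- `toGeomPoint (pointEquiv Q) = Q`. [folklore] -/
@[simp]
theorem toGeomPoint_pointEquiv (Q : W.geomPoints) : W.toGeomPoint (W.pointEquiv (L := K̄) Q) = Q :=
  (W.pointEquiv (L := K̄)).symm_apply_apply Q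

/-- `pointEquiv (toGeomPoint P) = P`. [folklore] -/
@[simp]
theorem pointEquiv_toGeomPoint (P : AlgPoints W.scheme K̄) : W.pointEquiv (L := K̄) (W.toGeomPoint P) = P :=
  (W.pointEquiv (L := K̄)).apply_symm_apply P

/-- `toGeomPoint` is a bijection. [folklore] -/
theorem toGeomPoint_bijective : Function.Bijective W.toGeomPoint :=
  (W.pointEquiv (L := K̄)).symm.bijective

/-- `toGeomPoint` carries `⟨P, Q⟩ ≫ add` to `+`. [folklore] -/
theorem toGeomPoint_lift_comp
    (hadd : ∀ P Q : W.geomPoints, lift (W.pointEquiv (L := AlgebraicClosure K) P)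
      (W.pointEquiv (L := AlgebraicClosure K) Q) ≫ add = W.pointEquiv (L := AlgebraicClosure K) (P + Q))
    (P Q : AlgPoints W.scheme K̄) :
    W.toGeomPoint (lift P Q ≫ add) = W.toGeomPoint P + W.toGeomPoint Q := by
  obtain ⟨P, rfl⟩ := (W.pointEquiv (L := K̄)).surjective P
  obtain ⟨Q, rfl⟩ := (W.pointEquiv (L := K̄)).surjective Q
  rw [hadd, toGeomPoint_pointEquiv, toGeomPoint_pointEquiv, toGeomPoint_pointEquiv]

/-- `toGeomPoint` carries `P ≫ neg` to negation. [folklore] -/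
theorem toGeomPoint_comp_neg
    (hneg : ∀ P : W.geomPoints, W.pointEquiv (L := AlgebraicClosure K) P ≫ neg =
      W.pointEquiv (L := AlgebraicClosure K) (-P))
    (P : AlgPoints W.scheme K̄) : W.toGeomPoint (P ≫ neg) = -W.toGeomPoint P := by
  obtain ⟨P, rfl⟩ := (W.pointEquiv (L := K̄)).surjective P
  rw [hneg, toGeomPoint_pointEquiv, toGeomPoint_pointEquiv]

omit [W.IsElliptic] in
/-- `toGeomPoint` carries the unit section to `0`. [folklore] -/
theorem toGeomPoint_toUnit_comp_oneHom [W.IsElliptic] :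
    W.toGeomPoint (toUnit (specOver K K̄) ≫ W.oneHom) = 0 := by
  rw [toUnit_comp_oneHom]
  exact (congrArg (W.pointEquiv (L := K̄)).symm (W.pointEquiv_zero (L := K̄))).symm.trans
    ((W.pointEquiv (L := K̄)).symm_apply_apply 0)

/-- **The group-scheme structure on `E_W`** with multiplication `add`, unit `O` and inverse `neg`
(Silverman, *AEC* III.3.6: the axioms hold on `K̄`-points, where `pointEquiv` identifies the
operations with Mathlib's group `W(K̄)`, hence as morphisms, `GrpObj.ofAlgPointsOfInjective`).
[cite: SilvermanAEC2009, III.3.6] -/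
@[implicit_reducible]
def grpObjOfAddHom
    (hadd : ∀ P Q : W.geomPoints, lift (W.pointEquiv (L := AlgebraicClosure K) P)
      (W.pointEquiv (L := AlgebraicClosure K) Q) ≫ add = W.pointEquiv (L := AlgebraicClosure K) (P + Q))
    (hneg : ∀ P : W.geomPoints, W.pointEquiv (L := AlgebraicClosure K) P ≫ neg =
      W.pointEquiv (L := AlgebraicClosure K) (-P)) : GrpObj W.scheme :=
  GrpObj.ofAlgPointsOfInjective (Ω := K̄) (mul := add) (one := W.oneHom) (inv := neg)
    W.toGeomPoint W.toGeomPoint_bijective.1 (W.toGeomPoint_lift_comp add hadd)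
    W.toGeomPoint_toUnit_comp_oneHom (W.toGeomPoint_comp_neg neg hneg)

/-- **`E_W` with this group structure is an abelian variety over `K`** (proper and geometrically
integral: `EllipticCurves/WeierstrassScheme`; Silverman, *AEC* III.3.6 / Mumford §4).
[cite: SilvermanAEC2009, III.3.6] -/
def abelianVarietyOfAddHom
    (hadd : ∀ P Q : W.geomPoints, lift (W.pointEquiv (L := AlgebraicClosure K) P)
      (W.pointEquiv (L := AlgebraicClosure K) Q) ≫ add = W.pointEquiv (L := AlgebraicClosure K) (P + Q))
    (hneg : ∀ P : W.geomPoints, W.pointEquiv (L := AlgebraicClosure K) P ≫ neg =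
      W.pointEquiv (L := AlgebraicClosure K) (-P)) : AbelianVariety K where
  X := W.scheme
  grpObj := W.grpObjOfAddHom add neg hadd hneg
  isProper := inferInstance
  geometricallyIntegral := inferInstance

/-- The underlying `K`-scheme of the model is `E_W`. [folklore] -/
theorem abelianVarietyOfAddHom_X
    (hadd : ∀ P Q : W.geomPoints, lift (W.pointEquiv (L := AlgebraicClosure K) P)
      (W.pointEquiv (L := AlgebraicClosure K) Q) ≫ add = W.pointEquiv (L := AlgebraicClosure K) (P + Q))
    (hneg : ∀ P : W.geomPoints, W.pointEquiv (L := AlgebraicClosure K) P ≫ neg =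
      W.pointEquiv (L := AlgebraicClosure K) (-P)) :
    (W.abelianVarietyOfAddHom add neg hadd hneg).X = W.scheme := rfl

/-- **The identification of geometric points `E_W(K̄) ≃+ W(K̄)`** (additive for the group structure
induced by `add`, `AlgPoints.addEquivOfBijective`). [cite: SilvermanAEC2009, III.2] -/
def geomPointsEquivOfAddHom
    (hadd : ∀ P Q : W.geomPoints, lift (W.pointEquiv (L := AlgebraicClosure K) P)
      (W.pointEquiv (L := AlgebraicClosure K) Q) ≫ add = W.pointEquiv (L := AlgebraicClosure K) (P + Q))
    (hneg : ∀ P : W.geomPoints, W.pointEquiv (L := AlgebraicClosure K) P ≫ neg =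
      W.pointEquiv (L := AlgebraicClosure K) (-P)) :
    (W.abelianVarietyOfAddHom add neg hadd hneg).geomPoints ≃+ W.geomPoints :=
  letI : GrpObj W.scheme := W.grpObjOfAddHom add neg hadd hneg
  AlgPoints.addEquivOfBijective (X := W.scheme) (L := K̄) W.toGeomPoint W.toGeomPoint_bijective
    (W.toGeomPoint_lift_comp add hadd)

/-- `geomPointsEquivOfAddHom P = pointEquiv⁻¹ P`. [folklore] -/
theorem geomPointsEquivOfAddHom_apply
    (hadd : ∀ P Q : W.geomPoints, lift (W.pointEquiv (L := AlgebraicClosure K) P)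
      (W.pointEquiv (L := AlgebraicClosure K) Q) ≫ add = W.pointEquiv (L := AlgebraicClosure K) (P + Q))
    (hneg : ∀ P : W.geomPoints, W.pointEquiv (L := AlgebraicClosure K) P ≫ neg =
      W.pointEquiv (L := AlgebraicClosure K) (-P))
    (P : (W.abelianVarietyOfAddHom add neg hadd hneg).geomPoints) :
    W.geomPointsEquivOfAddHom add neg hadd hneg P = W.toGeomPoint (Additive.toMul P) := rfl

/-- `(geomPointsEquivOfAddHom)⁻¹ Q = pointEquiv Q`. [folklore] -/
theorem geomPointsEquivOfAddHom_symm_apply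
    (hadd : ∀ P Q : W.geomPoints, lift (W.pointEquiv (L := AlgebraicClosure K) P)
      (W.pointEquiv (L := AlgebraicClosure K) Q) ≫ add = W.pointEquiv (L := AlgebraicClosure K) (P + Q))
    (hneg : ∀ P : W.geomPoints, W.pointEquiv (L := AlgebraicClosure K) P ≫ neg =
      W.pointEquiv (L := AlgebraicClosure K) (-P))
    (Q : W.geomPoints) :
    (W.geomPointsEquivOfAddHom add neg hadd hneg).symm Q = Additive.ofMul (W.pointEquiv (L := K̄) Q) := by
  apply (W.geomPointsEquivOfAddHom add neg hadd hneg).injective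
  rw [AddEquiv.apply_symm_apply, geomPointsEquivOfAddHom_apply]
  exact (W.toGeomPoint_pointEquiv Q).symm

/-- **`(E_W, Spec K[W] ↪ E_W, pointEquiv⁻¹)` is an abelian-variety model of `W`**
(`EllipticCurves/AbelianVarietyModel`; Silverman, *AEC* III.3.1(c), III.3.6).
[cite: SilvermanAEC2009, III.3.6] -/
theorem isAbelianVarietyModel_ofAddHom
    (hadd : ∀ P Q : W.geomPoints, lift (W.pointEquiv (L := AlgebraicClosure K) P)
      (W.pointEquiv (L := AlgebraicClosure K) Q) ≫ add = W.pointEquiv (L := AlgebraicClosure K) (P + Q))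
    (hneg : ∀ P : W.geomPoints, W.pointEquiv (L := AlgebraicClosure K) P ≫ neg =
      W.pointEquiv (L := AlgebraicClosure K) (-P)) :
    W.IsAbelianVarietyModel (W.abelianVarietyOfAddHom add neg hadd hneg) W.chartHom
      (W.geomPointsEquivOfAddHom add neg hadd hneg) where
  isOpenImmersion_chart := W.isOpenImmersion_chartHom
  chart_over := W.affineChart_over
  e_smul σ P := by
    rw [geomPointsEquivOfAddHom_apply, geomPointsEquivOfAddHom_apply]
    apply (W.pointEquiv (L := K̄)).injective
    change W.pointEquiv (W.toGeomPoint
        (HSMul.hSMul (α := K̄ ≃ₐ[K] K̄) σ (Additive.toMul P : AlgPoints W.scheme K̄))) =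
      W.pointEquiv (HSMul.hSMul (α := K̄ ≃ₐ[K] K̄) (β := (W.baseChange K̄).toAffine.Point)
        (γ := (W.baseChange K̄).toAffine.Point) σ (W.toGeomPoint (Additive.toMul P)))
    rw [pointEquiv_toGeomPoint, ← smul_pointEquiv, pointEquiv_toGeomPoint]
  e_symm_some x y h := by
    rw [geomPointsEquivOfAddHom_symm_apply]
    congr 1
    change W.pointEquiv (Affine.Point.some x y h) = _
    rw [pointEquiv_some]
    exact (W.chartPoint_affineChart x y h.1).symm

/-- **Existence of a model from the two morphisms.** [cite: SilvermanAEC2009, III.3.6] -/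
theorem exists_isAbelianVarietyModel_of_addHom
    (hadd : ∀ P Q : W.geomPoints, lift (W.pointEquiv (L := AlgebraicClosure K) P)
      (W.pointEquiv (L := AlgebraicClosure K) Q) ≫ add = W.pointEquiv (L := AlgebraicClosure K) (P + Q))
    (hneg : ∀ P : W.geomPoints, W.pointEquiv (L := AlgebraicClosure K) P ≫ neg =
      W.pointEquiv (L := AlgebraicClosure K) (-P)) :
    ∃ (A : AbelianVariety K) (c : Spec (CommRingCat.of W.toAffine.CoordinateRing) ⟶ A.X.left)
      (e : A.geomPoints ≃+ W.geomPoints), W.IsAbelianVarietyModel A c e :=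
  ⟨_, _, _, W.isAbelianVarietyModel_ofAddHom add neg hadd hneg⟩

end Model

/-! ### The bridge facts from addition and negation morphisms -/

section Facts

variable (W' : WeierstrassCurve K)

/-- **The full bridge fact for two elliptic curves each carrying addition and negation morphisms
with the chord–tangent values on `K̄`-points** (Silverman, *AEC* III.3.6 with III.4.8–4.9 via
`EllipticCurves/AbelianVarietyModelIsogeny`). [cite: SilvermanAEC2009, III.3.6] -/
theorem nonempty_abelianVarietyBridgeFull_of_addHom
    (h : ∀ [W.IsElliptic], ∃ (add : W.scheme ⊗ W.scheme ⟶ W.scheme) (neg : W.scheme ⟶ W.scheme),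
      (∀ P Q : W.geomPoints, lift (W.pointEquiv (L := AlgebraicClosure K) P)
        (W.pointEquiv (L := AlgebraicClosure K) Q) ≫ add = W.pointEquiv (L := AlgebraicClosure K) (P + Q)) ∧
      (∀ P : W.geomPoints, W.pointEquiv (L := AlgebraicClosure K) P ≫ neg =
        W.pointEquiv (L := AlgebraicClosure K) (-P)))
    (h' : ∀ [W'.IsElliptic], ∃ (add : W'.scheme ⊗ W'.scheme ⟶ W'.scheme) (neg : W'.scheme ⟶ W'.scheme),
      (∀ P Q : W'.geomPoints, lift (W'.pointEquiv (L := AlgebraicClosure K) P)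
        (W'.pointEquiv (L := AlgebraicClosure K) Q) ≫ add = W'.pointEquiv (L := AlgebraicClosure K) (P + Q)) ∧
      (∀ P : W'.geomPoints, W'.pointEquiv (L := AlgebraicClosure K) P ≫ neg =
        W'.pointEquiv (L := AlgebraicClosure K) (-P))) :
    nonempty_abelianVarietyBridgeFull W W' := by
  refine nonempty_abelianVarietyBridgeFull_of_models W W' ?_ ?_
  · intro _
    obtain ⟨add, neg, hadd, hneg⟩ := h
    exact W.exists_isAbelianVarietyModel_of_addHom add neg hadd hneg
  · intro _
    obtain ⟨add, neg, hadd, hneg⟩ := h'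
    exact W'.exists_isAbelianVarietyModel_of_addHom add neg hadd hneg

/-- **`nonempty_abelianVarietyBridge` from addition and negation morphisms.**
[cite: SilvermanAEC2009, III.3.6] -/
theorem nonempty_abelianVarietyBridge_of_addHom
    (h : ∀ [W.IsElliptic], ∃ (add : W.scheme ⊗ W.scheme ⟶ W.scheme) (neg : W.scheme ⟶ W.scheme),
      (∀ P Q : W.geomPoints, lift (W.pointEquiv (L := AlgebraicClosure K) P)
        (W.pointEquiv (L := AlgebraicClosure K) Q) ≫ add = W.pointEquiv (L := AlgebraicClosure K) (P + Q)) ∧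
      (∀ P : W.geomPoints, W.pointEquiv (L := AlgebraicClosure K) P ≫ neg =
        W.pointEquiv (L := AlgebraicClosure K) (-P)))
    (h' : ∀ [W'.IsElliptic], ∃ (add : W'.scheme ⊗ W'.scheme ⟶ W'.scheme) (neg : W'.scheme ⟶ W'.scheme),
      (∀ P Q : W'.geomPoints, lift (W'.pointEquiv (L := AlgebraicClosure K) P)
        (W'.pointEquiv (L := AlgebraicClosure K) Q) ≫ add = W'.pointEquiv (L := AlgebraicClosure K) (P + Q)) ∧
      (∀ P : W'.geomPoints, W'.pointEquiv (L := AlgebraicClosure K) P ≫ neg =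
        W'.pointEquiv (L := AlgebraicClosure K) (-P))) :
    nonempty_abelianVarietyBridge W W' :=
  nonempty_abelianVarietyBridge_of_full W W' (nonempty_abelianVarietyBridgeFull_of_addHom W W' h h')

/-- **`nonempty_abelianVarietyBridge_symm` from addition and negation morphisms.**
[cite: SilvermanAEC2009, III.3.6] -/
theorem nonempty_abelianVarietyBridge_symm_of_addHom
    (h : ∀ [W.IsElliptic], ∃ (add : W.scheme ⊗ W.scheme ⟶ W.scheme) (neg : W.scheme ⟶ W.scheme),
      (∀ P Q : W.geomPoints, lift (W.pointEquiv (L := AlgebraicClosure K) P)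
        (W.pointEquiv (L := AlgebraicClosure K) Q) ≫ add = W.pointEquiv (L := AlgebraicClosure K) (P + Q)) ∧
      (∀ P : W.geomPoints, W.pointEquiv (L := AlgebraicClosure K) P ≫ neg =
        W.pointEquiv (L := AlgebraicClosure K) (-P)))
    (h' : ∀ [W'.IsElliptic], ∃ (add : W'.scheme ⊗ W'.scheme ⟶ W'.scheme) (neg : W'.scheme ⟶ W'.scheme),
      (∀ P Q : W'.geomPoints, lift (W'.pointEquiv (L := AlgebraicClosure K) P)
        (W'.pointEquiv (L := AlgebraicClosure K) Q) ≫ add = W'.pointEquiv (L := AlgebraicClosure K) (P + Q)) ∧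
      (∀ P : W'.geomPoints, W'.pointEquiv (L := AlgebraicClosure K) P ≫ neg =
        W'.pointEquiv (L := AlgebraicClosure K) (-P))) :
    nonempty_abelianVarietyBridge_symm W W' :=
  nonempty_abelianVarietyBridge_symm_of_full W W' (nonempty_abelianVarietyBridgeFull_of_addHom W W' h h')

end Facts

end WeierstrassCurve
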